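import Literature.NumberTheory.LFunctions.RieszMeanInvDedekindZeta
import Mathlib.Algebra.Squarefree.Basic
import Mathlib.Data.Nat.Choose.Sum
import Mathlib.NumberTheory.LSeries.Convolution
import HarnessLib

/-!
# The Möbius function on the ideals of a Dedekind domain; `∑ μ_K(J) N(J)^{-s} = 1/ζ_K(s)`;
# Möbius sums over a number field with de la Vallée-Poussin error term

Topic `Literature/NumberTheory/LFunctions`, next to `IdealNormCount.lean` (`c_K(n)`, the
coefficients of `ζ_K`), `DedekindZetaVonMangoldt.lean` (`Λ_K`, `idealsOfNorm`) and
`RieszMeanInvDedekindZeta.lean` (logarithmic Riesz means of the coefficients of `H(s)/ζ_K(s)`).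

* `idealMoebius J` — the **Möbius function** `μ(J)` of a nonzero ideal `J` of a Dedekind domain:
  `(−1)^r` if `J` is a product of `r` distinct prime ideals, `0` otherwise (E. Landau,
  *Einführung in die elementare und analytische Theorie der algebraischen Zahlen und der Ideale*
  (1918), §§ on `μ(𝔞)`; D. R. Heath-Brown, Acta Math. 186 (2001), p. 18, "the Möbius function `μ(J)`
  for ideals"; G. Harman, *Prime-Detecting Sieves*, §13.4); `idealMoebius_top`, `idealMoebius_bot`,
  `idealMoebius_prod_eq` (`μ(∏_{P ∈ T} P) = (−1)^{|T|}` for distinct primes), `abs_idealMoebius_le_one`;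
* `sum_idealMoebius_of_dvd` — **Möbius inversion over ideals**: for `J ≠ 0`,
  `∑_{B ∣ J} μ(B) = [J = (1)]` (stated for every finset `D` with `B ∈ D ↔ B ∣ J`), by the bijection
  between the square-free divisors of `J` and the subsets of its prime factors and
  `∑_{T ⊆ S} (−1)^{|T|} = [S = ∅]`;
* `NumberField.idealMoebiusNormSum K n = m_K(n) = ∑_{N(J) = n} μ(J)` and
  **`NumberField.convolution_idealMoebiusNormSum_idealNormCount`**: `m_K ⋆ c_K = δ`, i.e.
  `∑_{ab = n} m_K(a) c_K(b) = [n = 1]` (regroup the pairs `(B, A)` with `N(B)N(A) = n` as `(J, B)` with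
  `N(J) = n`, `B ∣ J`); hence **`LSeries m_K · ζ_K = 1` on `Re s > 1`**
  (`NumberField.LSeries_idealMoebiusNormSum_mul_dedekindZeta`; Mathlib has the case `K = ℚ`,
  `LSeries_one_mul_Lseries_moebius`);
* **`NumberField.idealMoebius_logRieszMean_bound`** — Landau's Möbius prime-ideal theorem in the
  smoothed form of `RieszMeanInvDedekindZeta.lean`: for every number field `K` there are `c, C > 0` with
  `|∑_{N(J) ≤ x} μ(J) N(J)^{-1} log(x/N(J)) − 1/ρ_K| ≤ C exp(−c√(log x))` for all `x ≥ 1`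
  (`ρ_K = res_{s=1} ζ_K`), in the `ℕ`-grouped form `∑_{n ≤ x} m_K(n)/n · log(x/n)` and
  (`sum_Icc_idealMoebiusNormSum_mul_eq`) as a sum over ideals. This is the case `C = (1)` of the sum
  `Σ` of Heath-Brown's (8.7) (Acta Math. 186 (2001), p. 51: "`Σ = ∑_{N(B) < x, (B,C)=1} μ(B)N(B)^{-1}log(x/N(B))`
  … `= res + O(exp{−c√(log x)})`, the residue is easily found to be `γ₀^{-1}∏_{P∣C}(1 − N(P)^{-1})^{-1}`").

Everything is PROVED; the two `def`s carry their unfolding lemmas.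

## References

* E. Landau, *Über die zu einem algebraischen Zahlkörper gehörige Zetafunktion …*, J. reine angew.
  Math. 125 (1903); *Neuer Beweis des Primzahlsatzes und Beweis des Primidealsatzes*, Math. Ann. 56
  (1903), 645–670. [cite: LandauMathAnn1903, Part II]
* D. R. Heath-Brown, *Primes represented by `x³ + 2y³`*, Acta Math. 186 (2001), 1–84: p. 18 (the
  Möbius function for ideals, (3.12)) and p. 51 ((8.7) and the sum `Σ`).
  [cite: HeathBrownActa2001, §3 (3.12) and §8 p. 51]
* H. L. Montgomery, R. C. Vaughan, *Multiplicative Number Theory I*, CUP 2007, §6.2 (the case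
  `K = ℚ`: `M(x)`, Theorem 6.9 method). [cite: MontgomeryVaughan2007, §6.2]

## Mathlib / tree search

Mathlib: `UniqueFactorizationMonoid.normalizedFactors`, `normalizedFactors_prod_of_prime`,
`squarefree_iff_nodup_normalizedFactors`, `dvd_iff_normalizedFactors_le_normalizedFactors`,
`normalizedFactors_pos`, `Ideal.isUnit_iff`, `Finset.sum_powerset_neg_one_pow_card`,
`ArithmeticFunction.moebius` (on `ℕ` only; no Möbius function on ideals — `lean search 'moebius.*Ideal|Ideal.*moebius'`),
`LSeries.convolution_def`, `LSeries_convolution'`, `LSeries_delta`. Tree: `idealNormCount`,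
`idealsOfNorm`, `card_idealsOfNorm`, `LSeriesSummable_idealNormCount`, `dedekindZeta_eq_LSeries`,
`NumberField.logRieszMean_LSeries_div_dedekindZeta_bound`; the Heath-Brown files have a copy of `μ`
for `K = ℚ(2^{1/3})` only (`Literature.NumberTheory.Sieve.CubicSieve.idealMoebius`, same definition
with `#(primeFactorsFinset J)`).
-/

noncomputable section

open UniqueFactorizationMonoid Finset
open scoped NumberField

namespace Literature.NumberTheory.LFunctions

/-! ## The Möbius function of a Dedekind domain -/

section Dedekind

variable {R : Type*} [CommRing R] [IsDedekindDomain R]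

open scoped Classical in
/-- The **Möbius function on the ideals of a Dedekind domain**: `μ(J) = (−1)^r` if `J` is the product
of `r` distinct prime ideals (i.e. `J` is square-free with `r` prime factors), and `μ(J) = 0`
otherwise (in particular `μ(0) = 0`). For `R = ℤ` this is the classical Möbius function of `N(J)`.
[cite: HeathBrownActa2001, §3 (3.12)] -/
def idealMoebius (J : Ideal R) : ℤ :=
  if Squarefree J then (-1) ^ Multiset.card (normalizedFactors J) else 0

/-- Unfolding on square-free ideals. [folklore] -/
theorem idealMoebius_apply_of_squarefree {J : Ideal R} (h : Squarefree J) :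
    idealMoebius J = (-1) ^ Multiset.card (normalizedFactors J) := by
  rw [idealMoebius, if_pos h]

/-- `μ(J) = 0` unless `J` is square-free. [folklore] -/
theorem idealMoebius_apply_of_not_squarefree {J : Ideal R} (h : ¬Squarefree J) :
    idealMoebius J = 0 := by
  rw [idealMoebius, if_neg h]

/-- `μ(0) = 0`. [folklore] -/
theorem idealMoebius_bot : idealMoebius (⊥ : Ideal R) = 0 :=
  idealMoebius_apply_of_not_squarefree (by
    rw [← Ideal.zero_eq_bot]; exact not_squarefree_zero)

/-- `μ((1)) = 1`. [folklore] -/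
theorem idealMoebius_top : idealMoebius (⊤ : Ideal R) = 1 := by
  rw [← Ideal.one_eq_top, idealMoebius_apply_of_squarefree squarefree_one, normalizedFactors_one]
  simp

/-- `|μ(J)| ≤ 1`. [folklore] -/
theorem abs_idealMoebius_le_one (J : Ideal R) : |idealMoebius J| ≤ 1 := by
  by_cases h : Squarefree J
  · rw [idealMoebius_apply_of_squarefree h, abs_pow, abs_neg, abs_one, one_pow]
  · rw [idealMoebius_apply_of_not_squarefree h]; simp

/-- A product of distinct prime ideals is square-free, with the expected prime factorisation:
`normalizedFactors (∏_{P ∈ T} P) = T`. [folklore] -/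
theorem normalizedFactors_prod_eq_val {T : Finset (Ideal R)} (hT : ∀ P ∈ T, Prime P) :
    normalizedFactors (∏ P ∈ T, P) = T.val := by
  have h : (∏ P ∈ T, P) = T.val.prod := by
    rw [Finset.prod_eq_multiset_prod, Multiset.map_id']
  rw [h]
  exact normalizedFactors_prod_of_prime (fun P hP ↦ hT P hP)

/-- `∏_{P ∈ T} P ≠ 0` for a finset of primes. [folklore] -/
theorem prod_ne_bot_of_prime {T : Finset (Ideal R)} (hT : ∀ P ∈ T, Prime P) :
    (∏ P ∈ T, P) ≠ ⊥ := by
  rw [Ne, ← Ideal.zero_eq_bot, Finset.prod_eq_zero_iff]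
  rintro ⟨P, hP, h0⟩
  exact (hT P hP).ne_zero h0

/-- `∏_{P ∈ T} P` is square-free for distinct primes. [folklore] -/
theorem squarefree_prod_of_prime {T : Finset (Ideal R)} (hT : ∀ P ∈ T, Prime P) :
    Squarefree (∏ P ∈ T, P) := by
  rw [squarefree_iff_nodup_normalizedFactors (by
    rw [Ne, Ideal.zero_eq_bot]; exact prod_ne_bot_of_prime hT), normalizedFactors_prod_eq_val hT]
  exact T.nodup

/-- **`μ(∏_{P ∈ T} P) = (−1)^{|T|}`** for a finset `T` of prime ideals. [folklore] -/
theorem idealMoebius_prod_eq {T : Finset (Ideal R)} (hT : ∀ P ∈ T, Prime P) :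
    idealMoebius (∏ P ∈ T, P) = (-1) ^ T.card := by
  rw [idealMoebius_apply_of_squarefree (squarefree_prod_of_prime hT), normalizedFactors_prod_eq_val hT,
    Finset.card_def]

/-- A prime ideal `P ≠ 0` has `μ(P) = −1`. [folklore] -/
theorem idealMoebius_of_prime {P : Ideal R} (hP : Prime P) : idealMoebius P = -1 := by
  have := idealMoebius_prod_eq (T := {P}) (by simpa using hP)
  simpa using this

/-- **Möbius inversion over the ideals of a Dedekind domain**: for `J ≠ 0` and any finset `D`
consisting exactly of the divisors of `J`, `∑_{B ∈ D} μ(B) = 1` if `J = (1)` and `= 0` otherwise.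
Proof: only square-free divisors contribute; they correspond to the subsets `T` of the set `S` of
prime factors of `J` via `T ↦ ∏_{P∈T} P`, with `μ = (−1)^{|T|}`, and `∑_{T ⊆ S}(−1)^{|T|} = [S = ∅]`.
[cite: HeathBrownActa2001, §3 (3.12)] -/
theorem sum_idealMoebius_of_dvd {J : Ideal R} (hJ : J ≠ ⊥) {D : Finset (Ideal R)}
    (hD : ∀ B, B ∈ D ↔ B ∣ J) :
    ∑ B ∈ D, idealMoebius B = if J = ⊤ then 1 else 0 := by
  classical
  have hJ0 : (J : Ideal R) ≠ 0 := by rwa [Ne, Ideal.zero_eq_bot]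
  set S : Finset (Ideal R) := (normalizedFactors J).toFinset with hS
  have hSprime : ∀ P ∈ S, Prime P := fun P hP ↦
    prime_of_normalized_factor P (Multiset.mem_toFinset.1 hP)
  -- only square-free divisors contribute
  have h1 : ∑ B ∈ D, idealMoebius B = ∑ B ∈ D.filter Squarefree, idealMoebius B := by
    rw [Finset.sum_filter]
    refine Finset.sum_congr rfl fun B _ ↦ ?_
    split_ifs with h
    · rfl
    · exact idealMoebius_apply_of_not_squarefree h
  -- the bijection with the subsets of `S`
  have h2 : ∑ T ∈ S.powerset, (-1 : ℤ) ^ T.card = ∑ B ∈ D.filter Squarefree, idealMoebius B := by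
    refine Finset.sum_nbij' (fun T ↦ ∏ P ∈ T, P) (fun B ↦ (normalizedFactors B).toFinset)
      ?_ ?_ ?_ ?_ ?_
    · -- maps into square-free divisors
      intro T hT
      rw [Finset.mem_powerset] at hT
      have hTp : ∀ P ∈ T, Prime P := fun P hP ↦ hSprime P (hT hP)
      rw [Finset.mem_filter, hD]
      refine ⟨?_, squarefree_prod_of_prime hTp⟩
      rw [dvd_iff_normalizedFactors_le_normalizedFactors
        (by rw [Ne, Ideal.zero_eq_bot]; exact prod_ne_bot_of_prime hTp) hJ0,
        normalizedFactors_prod_eq_val hTp, Multiset.le_iff_subset T.nodup]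
      intro P hP
      exact Multiset.mem_toFinset.1 (hT hP)
    · -- the inverse maps into subsets of `S`
      intro B hB
      rw [Finset.mem_filter, hD] at hB
      obtain ⟨hBJ, hBsq⟩ := hB
      have hB0 : B ≠ 0 := fun h ↦ hJ0 (zero_dvd_iff.1 (h ▸ hBJ))
      rw [Finset.mem_powerset]
      intro P hP
      rw [Multiset.mem_toFinset] at hP ⊢
      exact Multiset.mem_of_le ((dvd_iff_normalizedFactors_le_normalizedFactors hB0 hJ0).1 hBJ) hP
    · -- left inverse
      intro T hT
      rw [Finset.mem_powerset] at hT
      have hTp : ∀ P ∈ T, Prime P := fun P hP ↦ hSprime P (hT hP)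
      simp only [normalizedFactors_prod_eq_val hTp, Finset.val_toFinset]
    · -- right inverse
      intro B hB
      rw [Finset.mem_filter, hD] at hB
      obtain ⟨hBJ, hBsq⟩ := hB
      have hB0 : B ≠ 0 := fun h ↦ hJ0 (zero_dvd_iff.1 (h ▸ hBJ))
      have hnd : (normalizedFactors B).Nodup := (squarefree_iff_nodup_normalizedFactors hB0).1 hBsq
      rw [Finset.prod_eq_multiset_prod, Multiset.map_id', Multiset.toFinset_val, hnd.dedup]
      exact associated_iff_eq.1 (prod_normalizedFactors hB0)
    · -- the summands agree
      intro T hT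
      rw [Finset.mem_powerset] at hT
      have hTp : ∀ P ∈ T, Prime P := fun P hP ↦ hSprime P (hT hP)
      rw [idealMoebius_prod_eq hTp]
  rw [h1, ← h2, Finset.sum_powerset_neg_one_pow_card]
  -- `S = ∅ ↔ J = (1)`
  have hiff : S = ∅ ↔ J = ⊤ := by
    rw [hS, Multiset.toFinset_eq_empty, ← Ideal.isUnit_iff]
    constructor
    · intro h
      by_contra hu
      have := (normalizedFactors_pos J hJ0).2 hu
      rw [h] at this
      exact lt_irrefl _ this
    · intro hu
      by_contra hne
      have hpos : 0 < normalizedFactors J := bot_lt_iff_ne_bot.2 hne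
      exact (normalizedFactors_pos J hJ0).1 hpos hu
  by_cases hJ1 : J = ⊤
  · rw [if_pos (hiff.2 hJ1), if_pos hJ1]
  · rw [if_neg (fun h ↦ hJ1 (hiff.1 h)), if_neg hJ1]

end Dedekind

/-! ## Number fields: `m_K(n) = ∑_{N(J) = n} μ(J)` and `∑ m_K(n) n^{-s} = 1/ζ_K(s)` -/

namespace NumberField

open LSeries
open scoped LSeries.notation

variable (K : Type*) [Field K] [NumberField K]

/-- `m_K(n) = ∑_{N(J) = n} μ(J)`, the `n`-th Dirichlet coefficient of `1/ζ_K(s) = ∑_J μ(J)N(J)^{-s}`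
(a sum over the finset `idealsOfNorm K n`; `m_K(0) = μ(0) = 0`). [folklore] -/
def idealMoebiusNormSum (n : ℕ) : ℤ := ∑ J ∈ idealsOfNorm K n, idealMoebius J

/-- Unfolding. [folklore] -/
theorem idealMoebiusNormSum_def (n : ℕ) :
    idealMoebiusNormSum K n = ∑ J ∈ idealsOfNorm K n, idealMoebius J := rfl

/-- `idealsOfNorm K 0 = {0}`. [folklore] -/
theorem idealsOfNorm_zero : idealsOfNorm K 0 = {⊥} := by
  ext I
  simp [Ideal.absNorm_eq_zero_iff]

/-- `m_K(0) = 0`. [folklore] -/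
theorem idealMoebiusNormSum_zero : idealMoebiusNormSum K 0 = 0 := by
  rw [idealMoebiusNormSum, idealsOfNorm_zero, Finset.sum_singleton, idealMoebius_bot]

/-- `m_K(1) = 1`. [folklore] -/
theorem idealMoebiusNormSum_one : idealMoebiusNormSum K 1 = 1 := by
  rw [idealMoebiusNormSum, idealsOfNorm_one, Finset.sum_singleton, idealMoebius_top]

/-- `|m_K(n)| ≤ c_K(n)`. [folklore] -/
theorem abs_idealMoebiusNormSum_le (n : ℕ) :
    |(idealMoebiusNormSum K n : ℝ)| ≤ idealNormCount K n := by
  rw [idealMoebiusNormSum, Int.cast_sum, ← card_idealsOfNorm]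
  refine (Finset.abs_sum_le_sum_abs _ _).trans ?_
  calc ∑ J ∈ idealsOfNorm K n, |(idealMoebius J : ℝ)| ≤ ∑ J ∈ idealsOfNorm K n, (1 : ℝ) :=
        Finset.sum_le_sum fun J _ ↦ by exact_mod_cast abs_idealMoebius_le_one J
    _ = (idealsOfNorm K n).card := by simp

variable {K} in
open scoped Classical in
/-- The divisors of a nonzero ideal `J` of norm `n`, as the finset of ideals of norm in `[1, n]`
dividing `J`. [folklore] -/
theorem mem_filter_dvd_iff {J B : Ideal (𝓞 K)} (hJ : J ≠ ⊥) :
    B ∈ ((Finset.Icc 1 (Ideal.absNorm J)).biUnion (idealsOfNorm K)).filter (· ∣ J) ↔ B ∣ J := by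
  simp only [Finset.mem_filter, Finset.mem_biUnion, Finset.mem_Icc, mem_idealsOfNorm,
    exists_eq_right', and_iff_right_iff_imp]
  intro hBJ
  have hn0 : Ideal.absNorm J ≠ 0 := by rwa [Ne, Ideal.absNorm_eq_zero_iff]
  have hdvd : Ideal.absNorm B ∣ Ideal.absNorm J := map_dvd Ideal.absNorm hBJ
  refine ⟨Nat.one_le_iff_ne_zero.2 fun h0 ↦ hn0 ?_, Nat.le_of_dvd (Nat.pos_of_ne_zero hn0) hdvd⟩
  exact Nat.eq_zero_of_zero_dvd (h0 ▸ hdvd)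

/-- **`m_K ⋆ c_K = δ`**: for `n ≠ 0`, `∑_{ab = n} m_K(a) c_K(b) = [n = 1]`. The pairs `(B, A)` with
`N(B) = a`, `N(A) = b`, `ab = n` are regrouped as the pairs `(J, B)` with `N(J) = n`, `B ∣ J`
(`J = BA`; cancellation of nonzero ideals), and `∑_{B ∣ J} μ(B) = [J = (1)]`
(`sum_idealMoebius_of_dvd`), while `(1)` is the only ideal of norm `1`. [folklore] -/
theorem sum_divisorsAntidiagonal_idealMoebiusNormSum_mul {n : ℕ} (hn : n ≠ 0) :
    ∑ p ∈ n.divisorsAntidiagonal, idealMoebiusNormSum K p.1 * (idealNormCount K p.2 : ℤ) =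
      if n = 1 then 1 else 0 := by
  classical
  -- both sides as sums over sigma-finsets
  have hL : ∑ p ∈ n.divisorsAntidiagonal, idealMoebiusNormSum K p.1 * (idealNormCount K p.2 : ℤ) =
      ∑ x ∈ n.divisorsAntidiagonal.sigma (fun p ↦ idealsOfNorm K p.1 ×ˢ idealsOfNorm K p.2),
        idealMoebius x.2.1 := by
    rw [Finset.sum_sigma]
    refine Finset.sum_congr rfl fun p _ ↦ ?_
    rw [idealMoebiusNormSum, ← card_idealsOfNorm, Finset.sum_product, Finset.sum_mul]
    refine Finset.sum_congr rfl fun B _ ↦ ?_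
    show idealMoebius B * _ = ∑ A ∈ idealsOfNorm K p.2, idealMoebius B
    rw [Finset.sum_const, nsmul_eq_mul, mul_comm]
  set Dv : Ideal (𝓞 K) → Finset (Ideal (𝓞 K)) := fun J ↦
    ((Finset.Icc 1 (Ideal.absNorm J)).biUnion (idealsOfNorm K)).filter (· ∣ J) with hDv
  have hR : (if n = 1 then (1 : ℤ) else 0) =
      ∑ y ∈ (idealsOfNorm K n).sigma Dv, idealMoebius y.2 := by
    rw [Finset.sum_sigma]
    have hJ : ∀ J ∈ idealsOfNorm K n, ∑ B ∈ Dv J, idealMoebius B = if J = ⊤ then 1 else 0 := by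
      intro J hJ
      rw [mem_idealsOfNorm] at hJ
      have hJ0 : J ≠ ⊥ := by rw [Ne, ← Ideal.absNorm_eq_zero_iff, hJ]; exact hn
      exact sum_idealMoebius_of_dvd hJ0 (fun B ↦ mem_filter_dvd_iff hJ0)
    rw [Finset.sum_congr rfl hJ, Finset.sum_ite_eq']
    by_cases h1 : n = 1
    · subst h1; simp [idealsOfNorm_one]
    · rw [if_neg h1, if_neg]
      rw [mem_idealsOfNorm, Ideal.absNorm_top]
      exact Ne.symm h1
  rw [hL, hR]
  -- the bijection `((a, b), (B, A)) ↦ (B * A, B)`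
  refine Finset.sum_bij (fun x _ ↦ ⟨x.2.1 * x.2.2, x.2.1⟩) ?_ ?_ ?_ ?_
  · rintro ⟨⟨a, b⟩, ⟨B, A⟩⟩ hx
    simp only [Finset.mem_sigma, Nat.mem_divisorsAntidiagonal, Finset.mem_product,
      mem_idealsOfNorm] at hx
    obtain ⟨⟨hab, -⟩, hB, hA⟩ := hx
    have hJn : Ideal.absNorm (B * A) = n := by rw [map_mul, hB, hA, hab]
    have hJ0 : B * A ≠ ⊥ := by rw [Ne, ← Ideal.absNorm_eq_zero_iff, hJn]; exact hn
    simp only [Finset.mem_sigma, mem_idealsOfNorm, hJn, true_and, hDv]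
    have := (mem_filter_dvd_iff hJ0).2 (dvd_mul_right B A)
    rwa [hJn] at this
  · rintro ⟨⟨a, b⟩, ⟨B, A⟩⟩ hx ⟨⟨a', b'⟩, ⟨B', A'⟩⟩ hx' h
    simp only [Finset.mem_sigma, Nat.mem_divisorsAntidiagonal, Finset.mem_product,
      mem_idealsOfNorm] at hx hx'
    simp only [Sigma.mk.injEq, heq_eq_eq] at h
    obtain ⟨hJ, rfl⟩ := h
    have hB0 : B ≠ 0 := by
      intro h0
      rw [h0, Ideal.zero_eq_bot, Ideal.absNorm_bot] at hx
      obtain ⟨⟨hab, -⟩, hB, -⟩ := hx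
      exact hn (by rw [← hab, ← hB]; simp)
    have hA : A = A' := mul_left_cancel₀ hB0 hJ
    subst hA
    obtain ⟨⟨-, -⟩, hB, hA⟩ := hx
    obtain ⟨⟨-, -⟩, hB', hA'⟩ := hx'
    simp [← hB, ← hB', ← hA, ← hA']
  · rintro ⟨J, B⟩ hy
    simp only [Finset.mem_sigma, mem_idealsOfNorm, hDv] at hy
    obtain ⟨hJn, hBmem⟩ := hy
    have hJ0 : J ≠ ⊥ := by rw [Ne, ← Ideal.absNorm_eq_zero_iff, hJn]; exact hn
    obtain ⟨A, rfl⟩ := (mem_filter_dvd_iff hJ0).1 hBmem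
    refine ⟨⟨⟨Ideal.absNorm B, Ideal.absNorm A⟩, ⟨B, A⟩⟩, ?_, rfl⟩
    simp only [Finset.mem_sigma, Nat.mem_divisorsAntidiagonal, Finset.mem_product, mem_idealsOfNorm,
      and_true, and_self]
    exact ⟨by rw [← map_mul, hJn], hn⟩
  · intro x _
    rfl

/-- **`m_K ⋆ c_K = δ`** as an identity of coefficient sequences (Mathlib's `LSeries.convolution`
and `LSeries.delta`). [folklore] -/
theorem convolution_idealMoebiusNormSum_idealNormCount :
    (fun n ↦ (idealMoebiusNormSum K n : ℂ)) ⍟ (fun n ↦ (idealNormCount K n : ℂ)) = δ := by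
  rw [convolution_def]
  funext n
  rcases eq_or_ne n 0 with rfl | hn
  · simp [delta]
  · have h := congrArg (fun z : ℤ ↦ (z : ℂ)) (sum_divisorsAntidiagonal_idealMoebiusNormSum_mul K hn)
    simp only [Int.cast_sum, Int.cast_mul, Int.cast_natCast] at h
    rw [h, delta]
    split_ifs <;> simp

/-- `∑ m_K(n) n^{-s}` converges absolutely for `Re s > 1` (`|m_K| ≤ c_K`). [folklore] -/
theorem LSeriesSummable_idealMoebiusNormSum {s : ℂ} (hs : 1 < s.re) :
    LSeriesSummable (fun n ↦ (idealMoebiusNormSum K n : ℂ)) s := by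
  refine Summable.of_norm_bounded (LSeriesSummable_idealNormCount K hs).norm fun n ↦ ?_
  refine norm_term_le s ?_
  rw [Complex.norm_intCast, Complex.norm_natCast]
  exact abs_idealMoebiusNormSum_le K n

/-- **`(∑ m_K(n) n^{-s}) · ζ_K(s) = 1` for `Re s > 1`**, i.e. `∑_J μ(J) N(J)^{-s} = 1/ζ_K(s)`
(Mathlib's `LSeries_one_mul_Lseries_moebius` is the case `K = ℚ`; E. Landau, *Einführung in die
elementare und analytische Theorie der algebraischen Zahlen und der Ideale* (1918), for general `K`).
[folklore] -/
theorem LSeries_idealMoebiusNormSum_mul_dedekindZeta {s : ℂ} (hs : 1 < s.re) :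
    LSeries (fun n ↦ (idealMoebiusNormSum K n : ℂ)) s * _root_.NumberField.dedekindZeta K s = 1 := by
  rw [dedekindZeta_eq_LSeries, ← LSeries_convolution' (LSeriesSummable_idealMoebiusNormSum K hs)
    (LSeriesSummable_idealNormCount K hs), convolution_idealMoebiusNormSum_idealNormCount,
    LSeries_delta, Pi.one_apply]

/-- `ζ_K(s) ≠ 0` and `∑ m_K(n) n^{-s} = ζ_K(s)⁻¹` for `Re s > 1`. [folklore] -/
theorem LSeries_idealMoebiusNormSum_eq_inv {s : ℂ} (hs : 1 < s.re) :
    LSeries (fun n ↦ (idealMoebiusNormSum K n : ℂ)) s = (_root_.NumberField.dedekindZeta K s)⁻¹ :=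
  eq_inv_of_mul_eq_one_left (LSeries_idealMoebiusNormSum_mul_dedekindZeta K hs)

/-! ## Möbius sums with de la Vallée-Poussin error term -/

/-- Regrouping a sum over `n ≤ N` weighted by `m_K(n)` as a sum over the ideals of norm `≤ N`:
`∑_{1 ≤ n ≤ N} m_K(n) g(n) = ∑_{1 ≤ N(J) ≤ N} μ(J) g(N(J))`. [folklore] -/
theorem sum_Icc_idealMoebiusNormSum_mul_eq {M : Type*} [AddCommMonoid M] [Module ℤ M]
    (g : ℕ → M) (N : ℕ) :
    ∑ n ∈ Finset.Icc 1 N, idealMoebiusNormSum K n • g n =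
      ∑ J ∈ (Finset.Icc 1 N).biUnion (idealsOfNorm K), idealMoebius J • g (Ideal.absNorm J) := by
  classical
  rw [Finset.sum_biUnion]
  · refine Finset.sum_congr rfl fun n _ ↦ ?_
    rw [idealMoebiusNormSum, Finset.sum_smul]
    refine Finset.sum_congr rfl fun J hJ ↦ ?_
    rw [mem_idealsOfNorm] at hJ
    rw [hJ]
  · intro a _ b _ hab
    refine Finset.disjoint_left.2 fun J ha hb ↦ hab ?_
    rw [mem_idealsOfNorm] at ha hb
    rw [← ha, ← hb]

/-- **Landau's Möbius prime-ideal theorem, logarithmically smoothed** (the case `C = (1)` of the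
sum `Σ` of Heath-Brown's (8.7), Acta Math. 186 (2001), p. 51; Montgomery–Vaughan §6.2 for `K = ℚ`):
for every number field `K` there are `c > 0`, `C > 0` with
`|∑_{n ≤ x} m_K(n) n^{-1} log(x/n) − 1/ρ_K| ≤ C exp(−c√(log x))` for all `x ≥ 1`, where
`m_K(n) = ∑_{N(J)=n} μ(J)` and `ρ_K = res_{s=1} ζ_K`. From
`logRieszMean_LSeries_div_dedekindZeta_bound` with `a = m_K`, `h = δ` (`H ≡ 1`, `B = 1`, `σ_h = 0`).
[cite: HeathBrownActa2001, §8 p. 51] -/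
theorem idealMoebius_logRieszMean_bound :
    ∃ c : ℝ, 0 < c ∧ ∃ C : ℝ, 0 < C ∧ ∀ x : ℝ, 1 ≤ x →
      ‖(∑ n ∈ Finset.Icc 1 ⌊x⌋₊, (idealMoebiusNormSum K n : ℂ) / n * (Real.log (x / n) : ℂ)) -
          1 / (_root_.NumberField.dedekindZeta_residue K : ℂ)‖ ≤
        C * Real.exp (-c * Real.sqrt (Real.log x)) := by
  obtain ⟨c, hc, C, hC, h⟩ := logRieszMean_LSeries_div_dedekindZeta_bound K (σₕ := 0) (by norm_num)
  refine ⟨c, hc, C, hC, fun x hx ↦ ?_⟩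
  have hδs : LSeriesSummable δ ((0 : ℝ) : ℂ) := by
    refine summable_of_ne_finset_zero (s := {1}) fun n hn ↦ ?_
    rw [Finset.mem_singleton] at hn
    rw [term_delta, if_neg hn]
  have hδB : ∑' n, ‖term δ ((0 : ℝ) : ℂ) n‖ ≤ 1 := by
    rw [tsum_eq_single 1 (fun n hn ↦ by rw [term_delta, if_neg hn, norm_zero]), term_delta, if_pos rfl,
      norm_one]
  have hrel : ∀ s : ℂ, 1 < s.re →
      LSeries (fun n ↦ (idealMoebiusNormSum K n : ℂ)) s * _root_.NumberField.dedekindZeta K s =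
        LSeries δ s := fun s hs ↦ by
    rw [LSeries_idealMoebiusNormSum_mul_dedekindZeta K hs, LSeries_delta, Pi.one_apply]
  have := h (fun n ↦ (idealMoebiusNormSum K n : ℂ)) δ 1 hδs hδB
    (fun σ hσ ↦ LSeriesSummable_idealMoebiusNormSum K (by simpa using hσ)) hrel x hx
  rw [LSeries_delta, Pi.one_apply, mul_one] at this
  exact this

/-- The same over ideals: `|∑_{N(J) ≤ x} μ(J) N(J)^{-1} log(x/N(J)) − 1/ρ_K| ≤ C exp(−c√(log x))`,
`x ≥ 1`, the sum running over the (finitely many) nonzero ideals of norm `≤ x`.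
[cite: HeathBrownActa2001, §8 p. 51] -/
theorem idealMoebius_logRieszMean_bound' :
    ∃ c : ℝ, 0 < c ∧ ∃ C : ℝ, 0 < C ∧ ∀ x : ℝ, 1 ≤ x →
      ‖(∑ J ∈ (Finset.Icc 1 ⌊x⌋₊).biUnion (idealsOfNorm K),
          (idealMoebius J : ℂ) / Ideal.absNorm J * (Real.log (x / Ideal.absNorm J) : ℂ)) -
          1 / (_root_.NumberField.dedekindZeta_residue K : ℂ)‖ ≤
        C * Real.exp (-c * Real.sqrt (Real.log x)) := by
  obtain ⟨c, hc, C, hC, h⟩ := idealMoebius_logRieszMean_bound K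
  refine ⟨c, hc, C, hC, fun x hx ↦ ?_⟩
  have key := sum_Icc_idealMoebiusNormSum_mul_eq K
    (fun n ↦ (1 : ℂ) / n * (Real.log (x / n) : ℂ)) ⌊x⌋₊
  simp only [zsmul_eq_mul] at key
  have hL : ∑ n ∈ Finset.Icc 1 ⌊x⌋₊, (idealMoebiusNormSum K n : ℂ) / n * (Real.log (x / n) : ℂ) =
      ∑ n ∈ Finset.Icc 1 ⌊x⌋₊, (idealMoebiusNormSum K n : ℂ) * (1 / (n : ℂ) * (Real.log (x / n) : ℂ)) :=
    Finset.sum_congr rfl fun n _ ↦ by ring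
  have hR : ∑ J ∈ (Finset.Icc 1 ⌊x⌋₊).biUnion (idealsOfNorm K),
      (idealMoebius J : ℂ) / Ideal.absNorm J * (Real.log (x / Ideal.absNorm J) : ℂ) =
      ∑ J ∈ (Finset.Icc 1 ⌊x⌋₊).biUnion (idealsOfNorm K),
        (idealMoebius J : ℂ) * (1 / (Ideal.absNorm J : ℂ) * (Real.log (x / Ideal.absNorm J) : ℂ)) :=
    Finset.sum_congr rfl fun J _ ↦ by ring
  have := h x hx
  rwa [hL, key, ← hR] at this

end NumberField

end Literature.NumberTheory.LFunctions

end
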